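import Summits.Ventures.DiscreteObjects.Hadamard.AutomorphismTransfer668
import Summits.Ventures.DiscreteObjects.Hadamard.GramTwoSquaresField
import Summits.Ventures.DiscreteObjects.Hadamard.SqrtTwoNorm668

/-!
# H(668): no automorphism of order 4 with fixed-point-free square — the block normal form (kernel, core case)

Framing: lottery ticket; floor = certified bounds/negative ranges.

Cell pub-namedobj (venture DiscreteObjects), target (H), hadamard gen 13; HANDOFF-H-g13 item 1 / FAMILY-F12-G13 §2.
If `g = (π, κ, d, e)` is a signed automorphism of an `H(668)` whose permutation pair has order `4` and whose square is
fixed-point-free, then (`hadamard668_involution_census_final`) `g²` is NEGA, so the signed permutation matrices satisfy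
`P⁴ = Q⁴ = −I` and `π, κ` are products of `167` four-cycles with cycle sign product `−1`; conjugating by signed permutations
(an equivalence of Hadamard matrices) brings such a `g` to the BLOCK NORMAL FORM treated here: index set `Fin 4 × R`
(`|R| = 167`), `π = κ = σ : (p, c) ↦ (p + 1, c)`, signs `d = e = d₀ : (p, c) ↦ (−1 if p = 3, else 1)`.

**`no_hadamard668_nega4_blockform`**: no Hadamard matrix on `Fin 4 × R`, `|R| = 167`, has the signed automorphism
`(σ, σ, d₀, d₀)`.  PROOF (the `√2`-folding): over `F = ℚ(√2)` (`QuadraticAlgebra ℚ 2 0`, `r = ω`, `r² = 2`) let `N₀` be the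
nega 4-cycle block, `P = diag(N₀, …, N₀)`, `S = P + Pᵀ` (`S² = 2`), and `U = diag(U₀, …)` with
`U₀ = [[2, r, 0, −r], [0, r, 2, r]]` (rows = a basis of the `√2`-eigenspace of `S₀`, `U₀ U₀ᵀ = 8·1`,
`U₀ᵀ U₀ = 4 + 2r S₀`).  With `R = 4 + 2r S`: `Uᵀ U = R`, `H R Hᵀ = 668·R` (`P H = H P`, `Pᵀ H = H Pᵀ`), `U R Uᵀ = 64·1`,
so `folding_two_squares_field` (on `|Fin 2 × R| = 334 ≡ 2 (mod 4)` coordinates) gives `668 = u² + v²` in `ℚ(√2)`,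
contradicting `not_sum_two_sq_668_sqrtTwo` (`167 = 13² − 2` splits in `ℚ(√2)`, `−1` is a non-residue mod `167`).
The transfer from an arbitrary `(π, κ, d, e)` of this shape to the block normal form (representatives of the 4-cycles,
re-signing) is HANDOFF-H-g13 item 1(c); the statement proved here is the normal-form core.  Ours; no `sorry`.
-/

namespace Summit.Ventures.DiscreteObjects.Hadamard

open Finset BigOperators Matrix QuadraticAlgebra

open Literature.Combinatorics.Designs.GoethalsSeidel (IsHadamardMatrix)

section intertwine
variable {ι : Type*} [Fintype ι] [DecidableEq ι] {F : Type*} [Field F]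

/-- `P H = H Q` for the signed permutation matrices of ANY signed automorphism (no involution hypothesis). -/
theorem sgnPerm_intertwine_gen {H : Matrix ι ι ℤ} {π κ : Equiv.Perm ι} {d e : ι → ℤ} (haut : IsSignedAut H π κ d e)
    (P Q : Matrix ι ι F) (hP : ∀ k i, P k i = if k = π i then (d i : F) else 0)
    (hQ : ∀ l j, Q l j = if l = κ j then (e j : F) else 0) :
    P * H.map (Int.castRingHom F) = H.map (Int.castRingHom F) * Q := by
  ext k j
  have he := haut.2.1
  have hA := haut.2.2
  rw [Matrix.mul_apply, Matrix.mul_apply]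
  have hl : ∑ i, P k i * (H.map (Int.castRingHom F)) i j = (d (π.symm k) : F) * H (π.symm k) j := by
    rw [Finset.sum_eq_single (π.symm k)]
    · simp [hP]
    · intro i _ hi
      have : k ≠ π i := fun h => hi (by rw [h, Equiv.symm_apply_apply])
      rw [hP, if_neg this, zero_mul]
    · intro h; exact absurd (Finset.mem_univ _) h
  have hr : ∑ l, (H.map (Int.castRingHom F)) k l * Q l j = (H k (κ j) : F) * e j := by
    rw [Finset.sum_eq_single (κ j)]
    · simp [hQ]
    · intro l _ hl
      rw [hQ, if_neg hl, mul_zero]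
    · intro h; exact absurd (Finset.mem_univ _) h
  rw [hl, hr]
  have h1 := hA (π.symm k) j
  rw [Equiv.apply_symm_apply] at h1
  have h1q : (H k (κ j) : F) = (d (π.symm k) : F) * e j * H (π.symm k) j := by
    have := congrArg (Int.cast : ℤ → F) h1; push_cast at this; exact this
  have hee : (e j : F) * e j = 1 := by
    have := congrArg (Int.cast : ℤ → F) (pm_mul_self (he j)); push_cast at this; exact this
  rw [h1q]
  linear_combination (-(d (π.symm k) : F) * (H (π.symm k) j : F)) * hee

/-- `Pᵀ H = H Qᵀ` likewise (`P`, `Q` are orthogonal). -/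
theorem sgnPerm_transpose_intertwine_gen {H : Matrix ι ι ℤ} {π κ : Equiv.Perm ι} {d e : ι → ℤ}
    (haut : IsSignedAut H π κ d e) (P Q : Matrix ι ι F) (hP : ∀ k i, P k i = if k = π i then (d i : F) else 0)
    (hQ : ∀ l j, Q l j = if l = κ j then (e j : F) else 0) :
    Pᵀ * H.map (Int.castRingHom F) = H.map (Int.castRingHom F) * Qᵀ := by
  ext k j
  have hd := haut.1
  have hA := haut.2.2
  rw [Matrix.mul_apply, Matrix.mul_apply]
  have hl : ∑ i, Pᵀ k i * (H.map (Int.castRingHom F)) i j = (d k : F) * H (π k) j := by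
    rw [Finset.sum_eq_single (π k)]
    · simp [hP]
    · intro i _ hi
      rw [transpose_apply, hP, if_neg hi, zero_mul]
    · intro h; exact absurd (Finset.mem_univ _) h
  have hr : ∑ l, (H.map (Int.castRingHom F)) k l * Qᵀ l j = (H k (κ.symm j) : F) * e (κ.symm j) := by
    rw [Finset.sum_eq_single (κ.symm j)]
    · simp [hQ]
    · intro l _ hl
      have : j ≠ κ l := fun h => hl (by rw [h, Equiv.symm_apply_apply])
      rw [transpose_apply, hQ, if_neg this, mul_zero]
    · intro h; exact absurd (Finset.mem_univ _) h
  rw [hl, hr]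
  have h1 := hA k (κ.symm j)
  rw [Equiv.apply_symm_apply] at h1
  have h1q : (H (π k) j : F) = (d k : F) * e (κ.symm j) * H k (κ.symm j) := by
    have := congrArg (Int.cast : ℤ → F) h1; push_cast at this; exact this
  have hdd : (d k : F) * d k = 1 := by
    have := congrArg (Int.cast : ℤ → F) (pm_mul_self (hd k)); push_cast at this; exact this
  rw [h1q]
  linear_combination ((e (κ.symm j) : F) * (H k (κ.symm j) : F)) * hdd

end intertwine

section core
variable {R : Type*} [Fintype R] [DecidableEq R]

/-- **No H(668) in block normal form with the standard nega 4-cycle symmetry.**  On the index set `Fin 4 × R`, `|R| = 167`,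
no Hadamard matrix admits the signed automorphism `(σ, σ, d₀, d₀)` with `σ (p, c) = (p + 1, c)` and
`d₀ (p, c) = −1` for `p = 3`, `+1` otherwise (so the signed permutation matrices satisfy `P⁴ = −I`). -/
theorem no_hadamard668_nega4_blockform (hR : Fintype.card R = 167) (H : Matrix (Fin 4 × R) (Fin 4 × R) ℤ)
    (hH : IsHadamardMatrix H)
    (haut : IsSignedAut H ((finRotate 4).prodCongr (Equiv.refl R)) ((finRotate 4).prodCongr (Equiv.refl R))
      (fun x => if x.1 = 3 then -1 else 1) (fun x => if x.1 = 3 then -1 else 1)) : False := by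
  haveI := sqrtTwo_field_fact
  -- the field ℚ(√2) and r = √2
  set r : QuadraticAlgebra ℚ 2 0 := ω with hrdef
  have hr2 : r * r = 2 := by
    rw [hrdef, omega_mul_omega_eq_mk]; ext <;> simp
  set σ : Equiv.Perm (Fin 4 × R) := (finRotate 4).prodCongr (Equiv.refl R) with hσdef
  set d₀ : Fin 4 × R → ℤ := fun x => if x.1 = 3 then -1 else 1 with hd₀def
  have hσ : ∀ x : Fin 4 × R, σ x = (x.1 + 1, x.2) := by
    rintro ⟨p, c⟩
    rw [hσdef, Equiv.prodCongr_apply, Prod.map_apply]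
    simp [finRotate_apply]
  -- cardinalities
  have hcard : Fintype.card (Fin 4 × R) = 668 := by rw [Fintype.card_prod, Fintype.card_fin, hR]
  have hα : Fintype.card (Fin 2 × R) % 4 = 2 := by rw [Fintype.card_prod, Fintype.card_fin, hR]
  -- H over F
  set Hq : Matrix (Fin 4 × R) (Fin 4 × R) (QuadraticAlgebra ℚ 2 0) := H.map (Int.castRingHom _) with hHqdef
  have hHq : Hq * Hqᵀ = ((668 : ℕ) : QuadraticAlgebra ℚ 2 0) • (1 : Matrix _ _ _) := by
    have h1 : Hq * Hqᵀ = (H * Hᵀ).map (Int.castRingHom _) := by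
      rw [Matrix.map_mul, hHqdef, transpose_map]
    rw [h1, hH.2, hcard]
    ext i j : 1
    rw [Matrix.map_apply, Matrix.smul_apply, Matrix.smul_apply, Matrix.one_apply, Matrix.one_apply]
    split_ifs <;> simp
  -- the blocks
  set N₀ : Matrix (Fin 4) (Fin 4) (QuadraticAlgebra ℚ 2 0) :=
    fun k i => if k = i + 1 then (if i = 3 then -1 else 1) else 0 with hN₀def
  set U₀ : Matrix (Fin 2) (Fin 4) (QuadraticAlgebra ℚ 2 0) :=
    !![2, r, 0, -r; 0, r, 2, r] with hU₀def
  have hA1 : U₀ * U₀ᵀ = (8 : QuadraticAlgebra ℚ 2 0) • (1 : Matrix (Fin 2) (Fin 2) _) := by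
    ext i j <;> fin_cases i <;> fin_cases j <;>
      simp [hU₀def, hrdef, Matrix.mul_apply, Fin.sum_univ_four] <;> norm_num
  have hA2 : U₀ᵀ * U₀ = (4 : QuadraticAlgebra ℚ 2 0) • 1 + ((2 : QuadraticAlgebra ℚ 2 0) * r) • (N₀ + N₀ᵀ) := by
    ext i j <;> fin_cases i <;> fin_cases j <;>
      simp [hU₀def, hN₀def, hrdef, Matrix.mul_apply, Fin.sum_univ_two, Matrix.add_apply] <;> norm_num
  -- global block-diagonal matrices
  set P : Matrix (Fin 4 × R) (Fin 4 × R) (QuadraticAlgebra ℚ 2 0) := blockDiagonal (fun _ : R => N₀) with hPdef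
  have hPspec : ∀ k i : Fin 4 × R, P k i = if k = σ i then (d₀ i : QuadraticAlgebra ℚ 2 0) else 0 := by
    rintro ⟨k, c⟩ ⟨i, c'⟩
    by_cases hc : c = c'
    · subst hc
      rw [hPdef, blockDiagonal_apply_eq, hσ]
      dsimp only
      have e1 : ((k, c) = (i + 1, c)) = (k = i + 1) := by
        rw [Prod.mk.injEq]; simp
      simp only [hN₀def, hd₀def, e1]
      split_ifs <;> simp
    · rw [hPdef, blockDiagonal_apply_ne _ _ _ hc, hσ]
      dsimp only
      rw [if_neg (fun h => hc (congrArg Prod.snd h))]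
  have hPH : P * Hq = Hq * P := sgnPerm_intertwine_gen haut P P hPspec hPspec
  have hPtH : Pᵀ * Hq = Hq * Pᵀ := sgnPerm_transpose_intertwine_gen haut P P hPspec hPspec
  set S : Matrix (Fin 4 × R) (Fin 4 × R) (QuadraticAlgebra ℚ 2 0) := P + Pᵀ with hSdef
  clear_value S
  have hS : S = blockDiagonal (fun _ : R => N₀ + N₀ᵀ) := by
    rw [hSdef, hPdef, blockDiagonal_transpose, ← blockDiagonal_add]
    rfl
  have hHS : Hq * S = S * Hq := by
    rw [hSdef, Matrix.mul_add, Matrix.add_mul, ← hPH, ← hPtH]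
  set U : Matrix (Fin 2 × R) (Fin 4 × R) (QuadraticAlgebra ℚ 2 0) := blockDiagonal (fun _ : R => U₀) with hUdef
  set Rm : Matrix (Fin 4 × R) (Fin 4 × R) (QuadraticAlgebra ℚ 2 0) :=
    (4 : QuadraticAlgebra ℚ 2 0) • 1 + ((2 : QuadraticAlgebra ℚ 2 0) * r) • S with hRmdef
  have hRm : Rm = blockDiagonal (fun _ : R => (4 : QuadraticAlgebra ℚ 2 0) • 1 +
      ((2 : QuadraticAlgebra ℚ 2 0) * r) • (N₀ + N₀ᵀ)) := by
    rw [hRmdef, hS]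
    have e1 : (fun _ : R => (4 : QuadraticAlgebra ℚ 2 0) • (1 : Matrix (Fin 4) (Fin 4) (QuadraticAlgebra ℚ 2 0)) +
        ((2 : QuadraticAlgebra ℚ 2 0) * r) • (N₀ + N₀ᵀ))
        = (4 : QuadraticAlgebra ℚ 2 0) • (1 : R → Matrix (Fin 4) (Fin 4) _) +
          ((2 : QuadraticAlgebra ℚ 2 0) * r) • (fun _ : R => N₀ + N₀ᵀ) := rfl
    rw [e1, blockDiagonal_add, blockDiagonal_smul, blockDiagonal_smul, blockDiagonal_one]
  -- the folding hypotheses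
  have hUU : U * Uᵀ = (8 : QuadraticAlgebra ℚ 2 0) • (1 : Matrix (Fin 2 × R) (Fin 2 × R) _) := by
    rw [hUdef, blockDiagonal_transpose, ← blockDiagonal_mul]
    have e1 : (fun _ : R => U₀ * U₀ᵀ) = (8 : QuadraticAlgebra ℚ 2 0) • (1 : R → Matrix (Fin 2) (Fin 2) _) := by
      funext c; rw [hA1]; rfl
    rw [e1, blockDiagonal_smul, blockDiagonal_one]
  have hV : Uᵀ * U = Rm := by
    rw [hRm, hUdef, blockDiagonal_transpose, ← blockDiagonal_mul]
    congr 1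
    funext c
    exact hA2
  have hHR : Hq * Rm * Hqᵀ = ((668 : ℕ) : QuadraticAlgebra ℚ 2 0) • Rm := by
    have h2 : Hq * S * Hqᵀ = ((668 : ℕ) : QuadraticAlgebra ℚ 2 0) • S := by
      rw [hHS, Matrix.mul_assoc, hHq, Matrix.mul_smul, Matrix.mul_one]
    rw [hRmdef]
    calc Hq * ((4 : QuadraticAlgebra ℚ 2 0) • 1 + ((2 : QuadraticAlgebra ℚ 2 0) * r) • S) * Hqᵀ
        = (4 : QuadraticAlgebra ℚ 2 0) • (Hq * Hqᵀ) + ((2 : QuadraticAlgebra ℚ 2 0) * r) • (Hq * S * Hqᵀ) := by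
          simp only [Matrix.mul_add, Matrix.add_mul, Matrix.mul_smul, Matrix.smul_mul, Matrix.mul_one]
      _ = (4 : QuadraticAlgebra ℚ 2 0) • (((668 : ℕ) : QuadraticAlgebra ℚ 2 0) • (1 : Matrix _ _ _)) +
            ((2 : QuadraticAlgebra ℚ 2 0) * r) • (((668 : ℕ) : QuadraticAlgebra ℚ 2 0) • S) := by rw [hHq, h2]
      _ = ((668 : ℕ) : QuadraticAlgebra ℚ 2 0) • ((4 : QuadraticAlgebra ℚ 2 0) • 1 +
            ((2 : QuadraticAlgebra ℚ 2 0) * r) • S) := by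
          rw [smul_add (((668 : ℕ)) : QuadraticAlgebra ℚ 2 0) ((4 : QuadraticAlgebra ℚ 2 0) • (1 : Matrix _ _ _))
              (((2 : QuadraticAlgebra ℚ 2 0) * r) • S),
            smul_smul, smul_smul, smul_smul, smul_smul, mul_comm (4 : QuadraticAlgebra ℚ 2 0),
            mul_comm ((2 : QuadraticAlgebra ℚ 2 0) * r)]
  have hU : U * Rm * Uᵀ = ((8 : QuadraticAlgebra ℚ 2 0) ^ 2) • (1 : Matrix (Fin 2 × R) (Fin 2 × R) _) := by
    rw [← hV]
    calc U * (Uᵀ * U) * Uᵀ = (U * Uᵀ) * (U * Uᵀ) := by simp only [Matrix.mul_assoc]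
      _ = ((8 : QuadraticAlgebra ℚ 2 0) ^ 2) • (1 : Matrix (Fin 2 × R) (Fin 2 × R) _) := by
          rw [hUU, Matrix.smul_mul, Matrix.one_mul, smul_smul, pow_two]
  have h8 : (8 : QuadraticAlgebra ℚ 2 0) ≠ 0 := by
    intro h; have := congrArg QuadraticAlgebra.re h; simp at this
  obtain ⟨u, v, huv⟩ := folding_two_squares_field Hq Rm Rm U U 668 (8 : QuadraticAlgebra ℚ 2 0) h8
    hV hHR hU (Equiv.refl _) hα
  exact not_sum_two_sq_668_sqrtTwo ⟨u, v, by rw [huv]; norm_num⟩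

end core

end Summit.Ventures.DiscreteObjects.Hadamard
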